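import Summits.QuantumFields.YangMills.Theorems.PoincareLipschitzSobolevScaledPoincareWirtinger
import Literature.MathematicalPhysics.QuantumFieldTheory.Balaban1983to89.B4Eq19LatticeOperators
import Mathlib.MeasureTheory.Function.L2Space
import HarnessLib

/-!
# LINE 25 «compactness_transfer» (stmt-QuantumFields-23533), S2♭″ brick (Γ5a) «SOBOLEV CELL-AVERAGE ROWS», FILE B —
# THE GRID CELL AS A HOMOTHETIC UNIT CUBE, (a-i) `‖R³∫_{cell} V‖ ≤ 1`, (a-iii) POINCARÉ–WIRTINGER ON A CELL WITH CONSTANT `C_P·R⁻¹`, and the `W^{1,2}` packaging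

Cell `ym3-torus` (YM ladder rung R3 — a RUNG, NOT the Clay problem: not d = 4, not infinite volume, not a mass gap); WIDTH COPY «width 15» of ym3-torus-p1,
gen 6; helper `--supports stmt-QuantumFields-23533`.  THEOREMS ONLY (0 `def`, default heartbeats).  Letters: the OPEN grid cell
`{x : EuclideanSpace ℝ (Fin 3) | ∀ i, (y i : ℝ) ∕ R < x i ∧ x i < ((y i : ℝ) + 1) ∕ R}` (`R : ℕ`, `y : Zd 3`) of w7's ✓`PoincareLipschitzSamplingCells`; the cube
`Q = {x | ∀ i, |x i| < 1}` of LINE 25; Sobolev data in lit `MemSobolevDomain` ∕ `HasWeakFDerivOn` vocabulary (LEAD cut (ii), S1″∕S2♭″).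

WHY (LEAD w1 g10 12:29:32Z S2♭″ ARCHITECTURE v0, (Γ5a) → px15).  For a general `W^{1,2}(Q; S³)` competitor `V` the recovery sequence samples the CELL AVERAGES
`a_R y := R³ • ∫_{cell_y} V`; (Γ5b)∕(Γ5) (w7) consume four rows about them.  THIS FILE lands: §1 the cell is open, the open unit cube is open∕convex∕bounded∕nonempty,
★`affinePreimage_cell` (`cell_y = y∕R + R⁻¹·Π(0,1)` in lit's `affinePreimage` letter), `volume_cell` (`= R⁻³`); §2 `smul_setIntegral_cell_eq_setAverage` (`R³•∫_{cell} V =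
⨍_{cell} V`), ★(a-i) `norm_smul_setIntegral_cell_le_one` (`‖V‖ ≤ 1` a.e. on the cell ⇒ `‖a_R y‖ ≤ 1`); §3 `hasWeakFDerivOn_mono`, ★`memSobolevDomain_one_two_of_bound`
(`W^{1,2}(Ω′)` on any finite-measure open `Ω′ ⊆ Ω` from a weak derivative on `Ω`, an a.e. bound on `f`, and square-integrable `x ↦ g x v` — how the cube data of S2♭″
feed each cell); §4 ★★(a-iii) `exists_eLpNorm_sub_average_cell_le` — ONE universal `C_P` with `‖V − ⨍_{cell} V‖_{L²(cell)} ≤ C_P·R⁻¹·‖GV‖_{L²(cell)}` for every `R ≥ 1`, `y`,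
`V ∈ W^{1,2}(cell)` (FILE A on the unit cube), ★★`exists_eLpNorm_sq_sub_smul_setIntegral_cell_le` (squared, in the `a_R` letter).  NEXT FILE (C): (a-ii) the translation
row `‖a_R(y+e_μ) − a_R y‖² ≤ R·∫_{cell ∪ cell′}‖GV·e_μ‖²` (lit ✓`eLpNorm_diffQuot_le` on the two-cell box) and (a-iv) the tiling sum over the cells of `Q_s`.  HONEST SCOPE:
NOTHING here proves Γ5, S2♭″, the organ, `BlockLipschitzL`, `HistoryTailL`, or any summit statement; YM₃ on T³ is rung R3, not Clay. [cite: Evans2010, §5.8.1 Thm. 1]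
-/

noncomputable section

open MeasureTheory Set Function Filter TopologicalSpace Metric Module
open scoped NNReal ENNReal Topology

namespace Summit.QuantumFields.YangMills.Theorems.PoincareLipschitzSobolevCellAverages

open Literature.Analysis.FunctionSpaces
open Literature.MathematicalPhysics.QuantumFieldTheory.Balaban1983to89
open B4Eq19LatticeOperators (Zd)
open Summit.QuantumFields.YangMills.Theorems.PoincareLipschitzSobolevScaledPoincareWirtinger

/-! ## §1 The open grid cell as a homothetic copy of the open unit cube -/

/-- The open grid cell `Π (yᵢ∕R, (yᵢ+1)∕R)` (w7's `PoincareLipschitzSamplingCells` letter) is open.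
[folklore] -/
theorem isOpen_cell (R : ℕ) (y : Zd 3) :
    IsOpen {x : EuclideanSpace ℝ (Fin 3) | ∀ i, (y i : ℝ) / R < x i ∧ x i < ((y i : ℝ) + 1) / R} := by
  have h : {x : EuclideanSpace ℝ (Fin 3) | ∀ i, (y i : ℝ) / R < x i ∧ x i < ((y i : ℝ) + 1) / R} =
      ⋂ i : Fin 3, {x | (y i : ℝ) / R < x i ∧ x i < ((y i : ℝ) + 1) / R} := by
    ext x; simp
  rw [h]
  exact isOpen_iInter_of_finite fun i =>
    (isOpen_lt continuous_const (EuclideanSpace.proj i).continuous).inter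
      (isOpen_lt (EuclideanSpace.proj i).continuous continuous_const)

/-- The open unit cube `Π (0, 1)` is open. [folklore] -/
theorem isOpen_unitCube :
    IsOpen {x : EuclideanSpace ℝ (Fin 3) | ∀ i, 0 < x i ∧ x i < 1} := by
  have h : {x : EuclideanSpace ℝ (Fin 3) | ∀ i, 0 < x i ∧ x i < 1} =
      ⋂ i : Fin 3, {x | 0 < x i ∧ x i < 1} := by
    ext x; simp
  rw [h]
  exact isOpen_iInter_of_finite fun i =>
    (isOpen_lt continuous_const (EuclideanSpace.proj i).continuous).inter
      (isOpen_lt (EuclideanSpace.proj i).continuous continuous_const)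

/-- The open unit cube is convex. [folklore] -/
theorem convex_unitCube : Convex ℝ {x : EuclideanSpace ℝ (Fin 3) | ∀ i, 0 < x i ∧ x i < 1} := by
  intro x hx z hz a b ha hb hab i
  have hxi := hx i
  have hzi := hz i
  have h1 : (a • x + b • z) i = a * x i + b * z i := by simp
  rw [h1]
  rcases ha.eq_or_lt with rfl | ha'
  · rw [zero_add] at hab
    rw [hab]; simpa using hzi
  · constructor
    · nlinarith [hxi.1, hzi.1]
    · have h2 : a * x i < a := mul_lt_of_lt_one_right ha' hxi.2
      have h3 : b * z i ≤ b := mul_le_of_le_one_right hb hzi.2.le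
      linarith

/-- The open unit cube is bounded (it lies in the closed ball of radius `2`). [folklore] -/
theorem isBounded_unitCube :
    Bornology.IsBounded {x : EuclideanSpace ℝ (Fin 3) | ∀ i, 0 < x i ∧ x i < 1} := by
  refine (isBounded_closedBall (x := (0 : EuclideanSpace ℝ (Fin 3))) (r := 2)).subset fun x hx => ?_
  rw [mem_closedBall, dist_zero_right, EuclideanSpace.norm_eq]
  have h1 : ∑ i : Fin 3, (x i) ^ 2 ≤ 3 := by
    have : ∀ i : Fin 3, (x i) ^ 2 ≤ 1 := fun i => by
      have := hx i; nlinarith [this.1, this.2]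
    calc ∑ i : Fin 3, (x i) ^ 2 ≤ ∑ _i : Fin 3, (1 : ℝ) := Finset.sum_le_sum fun i _ => this i
      _ = 3 := by simp
  have h2 : ∑ i : Fin 3, ‖x i‖ ^ 2 = ∑ i : Fin 3, (x i) ^ 2 :=
    Finset.sum_congr rfl fun i _ => by rw [Real.norm_eq_abs, sq_abs]
  rw [h2]
  calc Real.sqrt (∑ i : Fin 3, (x i) ^ 2) ≤ Real.sqrt 4 :=
        Real.sqrt_le_sqrt (by linarith)
    _ = 2 := by rw [show (4 : ℝ) = 2 ^ 2 by norm_num, Real.sqrt_sq (by norm_num)]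

/-- The open unit cube is nonempty. [folklore] -/
theorem unitCube_nonempty : ({x : EuclideanSpace ℝ (Fin 3) | ∀ i, 0 < x i ∧ x i < 1}).Nonempty :=
  ⟨WithLp.toLp 2 (fun _ => (1 / 2 : ℝ)), fun i => by simp; norm_num⟩

/-- ★ **The grid cell is the homothetic image of the unit cube**: with `x₀ = y∕R` and `γ = R⁻¹`,
`affinePreimage γ x₀ (cell_y) = unit cube`, i.e. `cell_y = y∕R + R⁻¹·Π(0,1)`. [folklore] -/
theorem affinePreimage_cell {R : ℕ} (hR : 0 < R) (y : Zd 3) :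
    affinePreimage ((R : ℝ)⁻¹) (WithLp.toLp 2 (fun i => (y i : ℝ) / R))
      (⟨{x : EuclideanSpace ℝ (Fin 3) | ∀ i, (y i : ℝ) / R < x i ∧ x i < ((y i : ℝ) + 1) / R},
        isOpen_cell R y⟩ : Opens (EuclideanSpace ℝ (Fin 3))) =
      ⟨{x : EuclideanSpace ℝ (Fin 3) | ∀ i, 0 < x i ∧ x i < 1}, isOpen_unitCube⟩ := by
  have hR0 : (0 : ℝ) < R := by exact_mod_cast hR
  ext x
  change (WithLp.toLp 2 (fun i => (y i : ℝ) / R) + (R : ℝ)⁻¹ • x) ∈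
      {x : EuclideanSpace ℝ (Fin 3) | ∀ i, (y i : ℝ) / R < x i ∧ x i < ((y i : ℝ) + 1) / R} ↔
    x ∈ {x : EuclideanSpace ℝ (Fin 3) | ∀ i, 0 < x i ∧ x i < 1}
  simp only [Set.mem_setOf_eq]
  refine forall_congr' fun i => ?_
  have h1 : (WithLp.toLp 2 (fun i => (y i : ℝ) / R) + (R : ℝ)⁻¹ • x) i = (y i : ℝ) / R + (R : ℝ)⁻¹ * x i := by
    simp
  rw [h1]
  constructor
  · rintro ⟨ha, hb⟩
    constructor
    · have : 0 < (R : ℝ)⁻¹ * x i := by linarith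
      exact (mul_pos_iff_of_pos_left (inv_pos.2 hR0)).1 this
    · have h2 : (R : ℝ)⁻¹ * x i < 1 / R := by
        have : ((y i : ℝ) + 1) / R = (y i : ℝ) / R + 1 / R := by ring
        linarith
      rw [one_div] at h2
      have := (mul_lt_iff_lt_one_right (inv_pos.2 hR0)).1 h2
      exact this
  · rintro ⟨ha, hb⟩
    constructor
    · have : 0 < (R : ℝ)⁻¹ * x i := mul_pos (inv_pos.2 hR0) ha
      linarith
    · have h2 : (R : ℝ)⁻¹ * x i < (R : ℝ)⁻¹ := by
        have := (mul_lt_iff_lt_one_right (inv_pos.2 hR0)).2 hb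
        exact this
      have : ((y i : ℝ) + 1) / R = (y i : ℝ) / R + (R : ℝ)⁻¹ := by
        rw [add_div, one_div]
      linarith

/-- The volume of the open grid cell is `R⁻³` (finite, nonzero). [folklore] -/
theorem volume_cell {R : ℕ} (hR : 0 < R) (y : Zd 3) :
    volume {x : EuclideanSpace ℝ (Fin 3) | ∀ i, (y i : ℝ) / R < x i ∧ x i < ((y i : ℝ) + 1) / R} =
      ENNReal.ofReal (((R : ℝ)⁻¹) ^ 3) := by
  have hR0 : (0 : ℝ) < R := by exact_mod_cast hR
  have h : {x : EuclideanSpace ℝ (Fin 3) | ∀ i, (y i : ℝ) / R < x i ∧ x i < ((y i : ℝ) + 1) / R} =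
      (WithLp.ofLp : EuclideanSpace ℝ (Fin 3) → (Fin 3 → ℝ)) ⁻¹'
        (Set.pi univ fun i => Ioo ((y i : ℝ) / R) (((y i : ℝ) + 1) / R)) := by
    ext x; simp [Set.mem_pi]
  rw [h, (PiLp.volume_preserving_ofLp (Fin 3)).measure_preimage
    (MeasurableSet.univ_pi fun i => measurableSet_Ioo).nullMeasurableSet, Real.volume_pi_Ioo]
  have hdiff : ∀ i : Fin 3, ((y i : ℝ) + 1) / R - (y i : ℝ) / R = (R : ℝ)⁻¹ := fun i => by
    field_simp; ring
  simp only [hdiff, Finset.prod_const, Finset.card_univ, Fintype.card_fin]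
  rw [ENNReal.ofReal_pow (inv_nonneg.2 hR0.le)]

/-- The real volume of the open grid cell is `R⁻³`. [folklore] -/
theorem volume_real_cell {R : ℕ} (hR : 0 < R) (y : Zd 3) :
    volume.real {x : EuclideanSpace ℝ (Fin 3) | ∀ i, (y i : ℝ) / R < x i ∧ x i < ((y i : ℝ) + 1) / R} =
      ((R : ℝ)⁻¹) ^ 3 := by
  rw [measureReal_def, volume_cell hR y, ENNReal.toReal_ofReal (by positivity)]

/-! ## §2 The cell average: (a-i) it is a sub-unit vector; it is the set average -/

/-- The scaled cell integral `R³ • ∫_{cell_y} V` IS the average `⨍_{cell_y} V`. [folklore] -/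
theorem smul_setIntegral_cell_eq_setAverage {R : ℕ} (hR : 0 < R) (y : Zd 3)
    (V : EuclideanSpace ℝ (Fin 3) → EuclideanSpace ℝ (Fin 4)) :
    ((R : ℝ) ^ 3) • ∫ x in {x : EuclideanSpace ℝ (Fin 3) |
        ∀ i, (y i : ℝ) / R < x i ∧ x i < ((y i : ℝ) + 1) / R}, V x =
      ⨍ x in {x : EuclideanSpace ℝ (Fin 3) | ∀ i, (y i : ℝ) / R < x i ∧ x i < ((y i : ℝ) + 1) / R}, V x := by
  rw [setAverage_eq, volume_real_cell hR y, inv_pow, inv_inv]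

/-- ★ **(a-i) Cell averages of a sub-unit map are sub-unit**: if `‖V x‖ ≤ 1` for a.e. `x` in the
cell, then `‖R³ • ∫_{cell_y} V‖ ≤ 1`. [folklore] -/
theorem norm_smul_setIntegral_cell_le_one {R : ℕ} (hR : 0 < R) (y : Zd 3)
    (V : EuclideanSpace ℝ (Fin 3) → EuclideanSpace ℝ (Fin 4))
    (hV : ∀ᵐ x ∂(volume.restrict {x : EuclideanSpace ℝ (Fin 3) |
        ∀ i, (y i : ℝ) / R < x i ∧ x i < ((y i : ℝ) + 1) / R}), ‖V x‖ ≤ 1) :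
    ‖((R : ℝ) ^ 3) • ∫ x in {x : EuclideanSpace ℝ (Fin 3) |
        ∀ i, (y i : ℝ) / R < x i ∧ x i < ((y i : ℝ) + 1) / R}, V x‖ ≤ 1 := by
  have hR0 : (0 : ℝ) < R := by exact_mod_cast hR
  have hfin : volume {x : EuclideanSpace ℝ (Fin 3) |
      ∀ i, (y i : ℝ) / R < x i ∧ x i < ((y i : ℝ) + 1) / R} < ∞ := by
    rw [volume_cell hR y]; exact ENNReal.ofReal_lt_top
  have h1 := norm_setIntegral_le_of_norm_le_const_ae hfin hV
  rw [volume_real_cell hR y, one_mul] at h1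
  rw [norm_smul, Real.norm_eq_abs, abs_of_pos (by positivity)]
  calc (R : ℝ) ^ 3 * ‖∫ x in {x : EuclideanSpace ℝ (Fin 3) |
          ∀ i, (y i : ℝ) / R < x i ∧ x i < ((y i : ℝ) + 1) / R}, V x‖
      ≤ (R : ℝ) ^ 3 * ((R : ℝ)⁻¹) ^ 3 := by gcongr
    _ = 1 := by rw [inv_pow, mul_inv_cancel₀ (by positivity)]

/-! ## §3 Sobolev packaging on a sub-domain: `W^{1,2}` data on a cell from the cube data -/

section Packaging

variable {E : Type*} [NormedAddCommGroup E] [InnerProductSpace ℝ E] [FiniteDimensional ℝ E]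
  [MeasurableSpace E] [BorelSpace E]
variable {F : Type*} [NormedAddCommGroup F] [NormedSpace ℝ F]

/-- A weak derivative on `Ω` restricts to any open `Ω' ⊆ Ω` (lit `HasWeakFDerivOn.mono_set_holds`).
[folklore] -/
theorem hasWeakFDerivOn_mono {Ω Ω' : Opens E} {f : E → F} {g : E → E →L[ℝ] F}
    (h : HasWeakFDerivOn Ω volume f g) (hle : Ω' ≤ Ω) : HasWeakFDerivOn Ω' volume f g :=
  HasWeakFDerivOn.mono_set_holds h hle

/-- ★ **`W^{1,2}` on a bounded sub-domain from an `L^∞` bound and square-integrable directional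
derivatives**: if `g` is a weak derivative of `f` on `Ω`, `‖f‖ ≤ M` a.e. on `Ω`, and every
`x ↦ g x v` is square-integrable on `Ω`, then `f ∈ W^{1,2}(Ω')` for every open `Ω' ⊆ Ω` of finite
measure. [folklore] -/
theorem memSobolevDomain_one_two_of_bound {Ω Ω' : Opens E} {f : E → F} {g : E → E →L[ℝ] F}
    (h : HasWeakFDerivOn Ω volume f g) (hle : Ω' ≤ Ω) (hfin : volume (Ω' : Set E) ≠ ∞) {M : ℝ}
    (hM : ∀ᵐ x ∂(volume.restrict (Ω : Set E)), ‖f x‖ ≤ M)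
    (hg : ∀ v : E, MemLp (fun x => g x v) 2 (volume.restrict (Ω : Set E))) :
    MemSobolevDomain 1 2 Ω' volume f := by
  haveI : IsFiniteMeasure (volume.restrict (Ω' : Set E)) := isFiniteMeasure_restrict.2 hfin
  have hsub : (Ω' : Set E) ⊆ (Ω : Set E) := hle
  have hmono : volume.restrict (Ω' : Set E) ≤ volume.restrict (Ω : Set E) :=
    Measure.restrict_mono hsub le_rfl
  have hfm : AEStronglyMeasurable f (volume.restrict (Ω' : Set E)) :=
    (h.locallyIntegrableOn.aestronglyMeasurable).mono_measure hmono
  have hf2 : MemLp f 2 (volume.restrict (Ω' : Set E)) :=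
    MemLp.of_bound hfm M (ae_mono hmono hM)
  refine (memSobolevDomain_succ_iff (k := 0)).2 ⟨hf2, g, hasWeakFDerivOn_mono h hle, fun v => ?_⟩
  rw [memSobolevDomain_zero_iff]
  exact (hg v).mono_measure hmono

end Packaging

/-! ## §4 (a-iii) The Poincaré–Wirtinger row on a cell, constant `C_P · R⁻¹` -/

/-- ★★ **(a-iii) POINCARÉ–WIRTINGER ON A GRID CELL FOR A SOBOLEV MAP**: there is a universal
`C_P` (the Sobolev Poincaré–Wirtinger constant of the open unit cube of `ℝ³` in `L²`) such that for
every `R ≥ 1`, every lattice point `y`, every `V ∈ W^{1,2}(cell_y; ℝ⁴)` with weak derivative `GV`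
on the open grid cell `cell_y = Π (yᵢ∕R, (yᵢ+1)∕R)`:
`‖V − ⨍_{cell_y} V‖_{L²(cell_y)} ≤ C_P · R⁻¹ · ‖GV‖_{L²(cell_y)}`
(scaled Poincaré–Wirtinger `exists_eLpNorm_sub_average_le_affine` on the homothetic copy
`cell_y = y∕R + R⁻¹·Π(0,1)` of the unit cube, `affinePreimage_cell`). [cite: Evans2010, §5.8.1 Thm. 1] -/
theorem exists_eLpNorm_sub_average_cell_le :
    ∃ C : ℝ≥0, ∀ (R : ℕ), 0 < R → ∀ (y : Zd 3)
      (V : EuclideanSpace ℝ (Fin 3) → EuclideanSpace ℝ (Fin 4))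
      (GV : EuclideanSpace ℝ (Fin 3) → EuclideanSpace ℝ (Fin 3) →L[ℝ] EuclideanSpace ℝ (Fin 4)),
      MemSobolevDomain 1 2 (⟨{x : EuclideanSpace ℝ (Fin 3) |
          ∀ i, (y i : ℝ) / R < x i ∧ x i < ((y i : ℝ) + 1) / R}, isOpen_cell R y⟩ : Opens _) volume V →
      HasWeakFDerivOn (⟨{x : EuclideanSpace ℝ (Fin 3) |
          ∀ i, (y i : ℝ) / R < x i ∧ x i < ((y i : ℝ) + 1) / R}, isOpen_cell R y⟩ : Opens _) volume V GV →
      eLpNorm (fun x => V x - ⨍ z in {x : EuclideanSpace ℝ (Fin 3) |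
          ∀ i, (y i : ℝ) / R < x i ∧ x i < ((y i : ℝ) + 1) / R}, V z) 2
        (volume.restrict {x : EuclideanSpace ℝ (Fin 3) |
          ∀ i, (y i : ℝ) / R < x i ∧ x i < ((y i : ℝ) + 1) / R}) ≤
      C * ENNReal.ofReal ((R : ℝ)⁻¹) * eLpNorm GV 2 (volume.restrict {x : EuclideanSpace ℝ (Fin 3) |
          ∀ i, (y i : ℝ) / R < x i ∧ x i < ((y i : ℝ) + 1) / R}) := by
  obtain ⟨C, hC⟩ := exists_eLpNorm_sub_average_le_affine (F := EuclideanSpace ℝ (Fin 4))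
    (⟨{x : EuclideanSpace ℝ (Fin 3) | ∀ i, 0 < x i ∧ x i < 1}, isOpen_unitCube⟩ : Opens _)
    convex_unitCube isBounded_unitCube unitCube_nonempty (p := 2) (by norm_num)
  refine ⟨C, fun R hR y V GV hV hGV => ?_⟩
  have hR0 : (0 : ℝ) < R := by exact_mod_cast hR
  exact hC (WithLp.toLp 2 (fun i => (y i : ℝ) / R)) ((R : ℝ)⁻¹) (inv_pos.2 hR0) _
    (affinePreimage_cell hR y) V GV hV hGV

/-- ★★ **(a-iii), squared, in the cell-average letter**: with the same universal `C_P`,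
`‖V − R³•∫_{cell_y} V‖²_{L²(cell_y)} ≤ C_P² · R⁻² · ‖GV‖²_{L²(cell_y)}`. [cite: Evans2010, §5.8.1 Thm. 1] -/
theorem exists_eLpNorm_sq_sub_smul_setIntegral_cell_le :
    ∃ C : ℝ≥0, ∀ (R : ℕ), 0 < R → ∀ (y : Zd 3)
      (V : EuclideanSpace ℝ (Fin 3) → EuclideanSpace ℝ (Fin 4))
      (GV : EuclideanSpace ℝ (Fin 3) → EuclideanSpace ℝ (Fin 3) →L[ℝ] EuclideanSpace ℝ (Fin 4)),
      MemSobolevDomain 1 2 (⟨{x : EuclideanSpace ℝ (Fin 3) |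
          ∀ i, (y i : ℝ) / R < x i ∧ x i < ((y i : ℝ) + 1) / R}, isOpen_cell R y⟩ : Opens _) volume V →
      HasWeakFDerivOn (⟨{x : EuclideanSpace ℝ (Fin 3) |
          ∀ i, (y i : ℝ) / R < x i ∧ x i < ((y i : ℝ) + 1) / R}, isOpen_cell R y⟩ : Opens _) volume V GV →
      eLpNorm (fun x => V x - ((R : ℝ) ^ 3) • ∫ z in {x : EuclideanSpace ℝ (Fin 3) |
          ∀ i, (y i : ℝ) / R < x i ∧ x i < ((y i : ℝ) + 1) / R}, V z) 2
        (volume.restrict {x : EuclideanSpace ℝ (Fin 3) |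
          ∀ i, (y i : ℝ) / R < x i ∧ x i < ((y i : ℝ) + 1) / R}) ^ 2 ≤
      (C : ℝ≥0∞) ^ 2 * ENNReal.ofReal (((R : ℝ)⁻¹) ^ 2) *
        eLpNorm GV 2 (volume.restrict {x : EuclideanSpace ℝ (Fin 3) |
          ∀ i, (y i : ℝ) / R < x i ∧ x i < ((y i : ℝ) + 1) / R}) ^ 2 := by
  obtain ⟨C, hC⟩ := exists_eLpNorm_sub_average_cell_le
  refine ⟨C, fun R hR y V GV hV hGV => ?_⟩
  have hR0 : (0 : ℝ) < R := by exact_mod_cast hR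
  have h := hC R hR y V GV hV hGV
  rw [← smul_setIntegral_cell_eq_setAverage hR y V] at h
  rw [ENNReal.ofReal_pow (inv_nonneg.2 hR0.le)]
  calc _ ≤ (C * ENNReal.ofReal ((R : ℝ)⁻¹) * eLpNorm GV 2 (volume.restrict {x : EuclideanSpace ℝ (Fin 3) |
          ∀ i, (y i : ℝ) / R < x i ∧ x i < ((y i : ℝ) + 1) / R})) ^ 2 := by gcongr
    _ = _ := by ring

end Summit.QuantumFields.YangMills.Theorems.PoincareLipschitzSobolevCellAverages

end
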